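import Literature.NumberTheory.EllipticCurves.IsogenyTwoPowerQuotientProofs
import HarnessLib

/-!
# Crux `MazurKenkuBound` (stmt-ABC-15125), line `radius-lite` — stub `stub_twoNormalize`:
# the kernel of a cyclic `2`-power isogeny in two-torsion normal form

Let `ψ : E → E'` be a cyclic isogeny of degree `2ᵏ`, `k ≥ 1`, of elliptic curves over a perfect
field `K` with `2 ≠ 0` (here `K = ℚ`). Its kernel `C₀ = E[ψ] ⊆ E(K̄)` is a `Γ_K`-stable cyclic
group of order `2ᵏ` (`Isogeny.map_smul`, `Isogeny.degree = #ker`, `Isogeny.IsCyclic`), so it has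
exactly one element `T₀` of order `2` (a finite cyclic group has `φ(2) = 1` elements of order `2`);
`σT₀` is again an element of order `2` of `C₀`, hence `σT₀ = T₀` for all `σ ∈ Γ_K`, and by
Galois descent (`fixedPoints_eq_range_map_holds`) `T₀` is the base change of a `K`-rational point
`T = (x₀, y₀)` with `2T = O`. The change of variables `(1, x₀, -a₁/2, y₀)` over `K` (Silverman,
*AEC*, X.4.9; the tree's `isTwoTorsionNF_smul_of_two_nsmul_eq_zero`) puts `E` in two-torsion
normal form `V : y² = x³ + ax² + bx` with `T ↦ (0, 0)`, and the isomorphism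
`ι = VariableChange.toIsogeny E C : E ≅ V` over `K` carries `C₀` to a `Γ_K`-stable cyclic
subgroup `C = ι(C₀) ⊆ V(K̄)` of order `2ᵏ` whose unique element of order `2` is `ι(T₀) = (0, 0)`.
This is the first step of the modular-curve-free treatment of Kenku's level `32` in the lead's
skeleton (a chain of Silverman's explicit `2`-isogenies, *AEC* III.4 Example 4.5).

## Contents

* `Summit.ABC.ABC.Theorems.exists_twoTorsionNF_of_isCyclic_isogeny` — the statement over any
  perfect field with `2 ≠ 0`;
* `Summit.ABC.ABC.Theorems.stub_twoNormalize` — the registered stub (over `ℚ`).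

## References

* [SilvermanAEC2009] J. H. Silverman, *The Arithmetic of Elliptic Curves*, 2nd ed., GTM 106
  (2009), III.1 Table 3.1 and X.4.9 (moving a rational `2`-torsion point to `(0, 0)`),
  III.3.1(b) (changes of variables are isomorphisms), III.4 Example 4.5, I.§1 and VIII.§1
  (Galois descent for points).
-/

-- `Summit.ABC.ABC` is the mandated summit-side namespace (CONVENTIONS §2); the duplicate is deliberate.
set_option linter.dupNamespace false

noncomputable section

open scoped Classical
open WeierstrassCurve
open Literature.NumberTheory.EllipticCurves

namespace Summit.ABC.ABC.Theorems

universe u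

/-! ### Two facts on finite cyclic groups -/

/-- A finite cyclic subgroup has at most one element of order `2`: the number of elements of
order `d` in a cyclic group of order `n`, `d ∣ n`, is `φ(d)`, and `φ(2) = 1`. [folklore] -/
private theorem eq_of_two_nsmul_eq_zero_of_isAddCyclic {G : Type*} [AddCommGroup G]
    (H : AddSubgroup G) [IsAddCyclic H] [Finite H] {P Q : G} (hP : P ∈ H) (hQ : Q ∈ H)
    (h2P : 2 • P = 0) (hP0 : P ≠ 0) (h2Q : 2 • Q = 0) (hQ0 : Q ≠ 0) : P = Q := by
  haveI := Fintype.ofFinite H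
  have hP2 : addOrderOf (⟨P, hP⟩ : H) = 2 :=
    (AddSubgroup.addOrderOf_mk P hP).trans (addOrderOf_eq_prime h2P hP0)
  have hQ2 : addOrderOf (⟨Q, hQ⟩ : H) = 2 :=
    (AddSubgroup.addOrderOf_mk Q hQ).trans (addOrderOf_eq_prime h2Q hQ0)
  have hdvd : 2 ∣ Fintype.card H := hP2 ▸ addOrderOf_dvd_card
  obtain ⟨a, ha⟩ := Finset.card_eq_one.mp
    ((IsAddCyclic.card_addOrderOf_eq_totient hdvd).trans Nat.totient_two)
  have hPa : (⟨P, hP⟩ : H) ∈ ({a} : Finset H) := by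
    rw [← ha]
    exact Finset.mem_filter.mpr ⟨Finset.mem_univ _, hP2⟩
  have hQa : (⟨Q, hQ⟩ : H) ∈ ({a} : Finset H) := by
    rw [← ha]
    exact Finset.mem_filter.mpr ⟨Finset.mem_univ _, hQ2⟩
  rw [Finset.mem_singleton] at hPa hQa
  exact congrArg Subtype.val (hPa.trans hQa.symm)

/-- A cyclic subgroup of order `2ᵏ`, `k ≥ 1`, contains an element of order `2`, namely `2ᵏ⁻¹ g`
for a generator `g`. [folklore] -/
private theorem exists_two_nsmul_eq_zero_of_card_eq {G : Type*} [AddCommGroup G]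
    (H : AddSubgroup G) [IsAddCyclic H] {k : ℕ} (hk : 1 ≤ k) (hcard : Nat.card H = 2 ^ k) :
    ∃ T ∈ H, 2 • T = 0 ∧ T ≠ 0 := by
  obtain ⟨g, hg⟩ := IsAddCyclic.exists_ofOrder_eq_natCard (α := H)
  rw [hcard, ← AddSubgroup.addOrderOf_coe] at hg
  refine ⟨2 ^ (k - 1) • (g : G), H.nsmul_mem g.2 _, ?_, ?_⟩
  · rw [smul_smul, ← pow_succ', show k - 1 + 1 = k by omega, ← hg]
    exact addOrderOf_nsmul_eq_zero _
  · intro h0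
    have hdvd := addOrderOf_dvd_of_nsmul_eq_zero h0
    rw [hg, Nat.pow_dvd_pow_iff_le_right Nat.one_lt_two] at hdvd
    omega

/-! ### From a curve in two-torsion normal form to the literal equation -/

/-- Bookkeeping: a curve `V` in two-torsion normal form *is* the literal equation
`⟨0, a₂(V), 0, a₄(V), 0⟩`, so data on `V` (a `Γ_K`-stable cyclic subgroup of `V(K̄)` of order
`2ᵏ` whose elements of order `2` are `T = (0, 0)`) are data on that literal equation. [folklore] -/
private theorem exists_literal_of_isTwoTorsionNF {K : Type u} [Field K] (V : WeierstrassCurve K)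
    [hV : V.IsTwoTorsionNF] [hE : V.IsElliptic] (C : AddSubgroup V.geomPoints) (k : ℕ)
    (hst : ∀ σ : Field.absoluteGaloisGroup K, ∀ P ∈ C, σ • P ∈ C) (hcyc : IsAddCyclic C)
    (hcard : Nat.card C = 2 ^ k)
    (h2 : ∀ P ∈ C, 2 • P = 0 → P ≠ 0 → P = V.geomTwoTorsionPoint) :
    ∃ (a b : K) (_ : (⟨0, a, 0, b, 0⟩ : WeierstrassCurve K).IsElliptic)
      (C' : AddSubgroup (⟨0, a, 0, b, 0⟩ : WeierstrassCurve K).geomPoints),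
      (∀ σ : Field.absoluteGaloisGroup K, ∀ P ∈ C', σ • P ∈ C') ∧ IsAddCyclic C' ∧
        Nat.card C' = 2 ^ k ∧
        ∀ P ∈ C', 2 • P = 0 → P ≠ 0 →
          P = (⟨0, a, 0, b, 0⟩ : WeierstrassCurve K).geomTwoTorsionPoint := by
  obtain ⟨v₁, v₂, v₃, v₄, v₆⟩ := V
  have h₁ : v₁ = 0 := hV.a₁
  have h₃ : v₃ = 0 := hV.a₃
  have h₆ : v₆ = 0 := hV.a₆
  subst h₁ h₃ h₆
  exact ⟨v₂, v₄, hE, C, hst, hcyc, hcard, h2⟩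

/-! ### The normalisation -/

/-- **Two-torsion normal form of a cyclic `2`-power isogeny kernel.** Let `K` be a perfect field
with `2 ≠ 0` and `ψ : E → E'` a cyclic isogeny of degree `2ᵏ`, `k ≥ 1`, out of an elliptic curve
`E` over `K`. Then on some `K`-isomorphic model `y² = x³ + ax² + bx` of `E` there is a
`Γ_K`-stable cyclic subgroup of `K̄`-points of order `2ᵏ` whose element of order `2` is
`T = (0, 0)`: the kernel `E[ψ]` is `Γ_K`-stable (`ψ` is defined over `K`) and cyclic of order
`2ᵏ`, its unique element `T₀` of order `2` is therefore `Γ_K`-fixed, hence `K`-rational (Galois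
descent, Silverman *AEC* I.§1, VIII.§1), the change of variables `(1, x(T₀), -a₁/2, y(T₀))`
over `K` moves it to `(0, 0)` and kills `a₁, a₃, a₆` (Silverman, *AEC*, X.4.9), and the
isomorphism `E ≅ C • E` (an isogeny over `K`, *AEC* III.3.1(b)) transports the kernel.
[cite: SilvermanAEC2009, III.4 Example 4.5, X.4.9] -/
theorem exists_twoTorsionNF_of_isCyclic_isogeny {K : Type u} [Field K] [PerfectField K]
    (htwo : (2 : K) ≠ 0) (W W' : WeierstrassCurve K) [W.IsElliptic] (ψ : Isogeny W W') {k : ℕ}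
    (hk : 1 ≤ k) (hcyc : ψ.IsCyclic) (hdeg : ψ.degree = 2 ^ k) :
    ∃ (a b : K) (_ : (⟨0, a, 0, b, 0⟩ : WeierstrassCurve K).IsElliptic)
      (C : AddSubgroup (⟨0, a, 0, b, 0⟩ : WeierstrassCurve K).geomPoints),
      (∀ σ : Field.absoluteGaloisGroup K, ∀ P ∈ C, σ • P ∈ C) ∧ IsAddCyclic C ∧
        Nat.card C = 2 ^ k ∧
        ∀ P ∈ C, 2 • P = 0 → P ≠ 0 →
          P = (⟨0, a, 0, b, 0⟩ : WeierstrassCurve K).geomTwoTorsionPoint := by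
  -- the kernel `C₀ = E[ψ]`: cyclic of order `2ᵏ`, `Γ_K`-stable
  haveI : IsAddCyclic ψ.toAddMonoidHom.ker := hcyc
  haveI : Finite ψ.toAddMonoidHom.ker := ψ.finite_ker'
  have hcard₀ : Nat.card ψ.toAddMonoidHom.ker = 2 ^ k := hdeg
  have hst₀ : ∀ σ : Field.absoluteGaloisGroup K, ∀ P ∈ ψ.toAddMonoidHom.ker,
      σ • P ∈ ψ.toAddMonoidHom.ker := fun σ P hP ↦ by
    rw [AddMonoidHom.mem_ker, Isogeny.coe_toAddMonoidHom] at hP ⊢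
    rw [ψ.map_smul, hP, smul_zero]
  -- its unique element `T₀` of order `2`, which is `Γ_K`-fixed
  obtain ⟨T₀, hT₀C, h2T₀, hT₀0⟩ :=
    exists_two_nsmul_eq_zero_of_card_eq ψ.toAddMonoidHom.ker hk hcard₀
  have huniq : ∀ P ∈ ψ.toAddMonoidHom.ker, 2 • P = 0 → P ≠ 0 → P = T₀ := fun P hP h2P hP0 ↦
    eq_of_two_nsmul_eq_zero_of_isAddCyclic ψ.toAddMonoidHom.ker hP hT₀C h2P hP0 h2T₀ hT₀0
  have hfix : ∀ σ : Field.absoluteGaloisGroup K, σ • T₀ = T₀ := fun σ ↦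
    huniq _ (hst₀ σ _ hT₀C) (by rw [smul_comm, h2T₀, smul_zero])
      ((smul_ne_zero_iff_ne σ).mpr hT₀0)
  -- hence `K`-rational: `T₀ = T = (x₀, y₀)` with `2T = O`, `y₀ = -y₀ - a₁x₀ - a₃`
  obtain ⟨T, hT⟩ := exists_toGeomPoints_eq_of_forall_smul_eq W hfix
  subst hT
  rcases T with _ | ⟨x₀, y₀, h₀⟩
  · exact absurd (map_zero _) hT₀0
  have h2T : 2 • (Affine.Point.some x₀ y₀ h₀ : W.toAffine.Point) = 0 :=
    W.toGeomPoints_injective (by rw [map_nsmul, h2T₀, map_zero])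
  have hy₀ : y₀ = W.toAffine.negY x₀ y₀ := by
    by_contra hy
    apply Affine.Point.some_ne_zero (Affine.nonsingular_add h₀ h₀ fun hxy ↦ hy hxy.right)
    rw [← Affine.Point.add_self_of_Y_ne (h₁ := h₀) hy, ← two_nsmul, h2T]
  -- the normal form `V = Cv • W` and the isomorphism `ι : W ≅ V`, with `ι T₀ = (0, 0)`
  set Cv : VariableChange K := ⟨1, x₀, -W.a₁ / 2, y₀⟩ with hCv
  haveI : (Cv • W).IsTwoTorsionNF := isTwoTorsionNF_smul_of_two_nsmul_eq_zero htwo h₀ hy₀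
  have hTT : VariableChange.toIsogeny W Cv (W.toGeomPoints (Affine.Point.some x₀ y₀ h₀)) =
      (Cv • W).geomTwoTorsionPoint := by
    obtain ⟨hns, e₀⟩ : ∃ hns, W.toGeomPoints (Affine.Point.some x₀ y₀ h₀) =
        Affine.Point.some (algebraMap K (AlgebraicClosure K) x₀)
          (algebraMap K (AlgebraicClosure K) y₀) hns := ⟨_, rfl⟩
    rw [e₀, VariableChange.toIsogeny_some]
    have hx : (Cv.map (algebraMap K (AlgebraicClosure K))).toX
        (algebraMap K (AlgebraicClosure K) x₀) = 0 := by
      simp [hCv, VariableChange.toX_def, VariableChange.map]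
    have hy : (Cv.map (algebraMap K (AlgebraicClosure K))).toY
        (algebraMap K (AlgebraicClosure K) x₀) (algebraMap K (AlgebraicClosure K) y₀) = 0 := by
      simp [hCv, VariableChange.toY_def, VariableChange.map]
    obtain ⟨h', e'⟩ := UnivEC.some_eq_some_of_eq hx hy
      ((VariableChange.baseChange_smul_eq W Cv (AlgebraicClosure K)) ▸
        (VariableChange.nonsingular_iff (W.baseChange (AlgebraicClosure K))
          (Cv.map (algebraMap K (AlgebraicClosure K))) _ _).mpr hns)
    exact e'
  -- transport of the kernel along `ι`
  have hinj : Function.Injective (VariableChange.toIsogeny W Cv).toAddMonoidHom :=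
    VariableChange.toIsogeny_injective W Cv
  refine exists_literal_of_isTwoTorsionNF (Cv • W)
    (ψ.toAddMonoidHom.ker.map (VariableChange.toIsogeny W Cv).toAddMonoidHom) k
    ?_ ?_ ?_ ?_
  · rintro σ P ⟨Q, hQ, rfl⟩
    exact AddSubgroup.mem_map.mpr ⟨σ • Q, hst₀ σ Q hQ, (VariableChange.toIsogeny W Cv).map_smul σ Q⟩
  · exact isAddCyclic_of_surjective _ (ψ.toAddMonoidHom.ker.equivMapOfInjective _ hinj).surjective
  · exact (Nat.card_congr (ψ.toAddMonoidHom.ker.equivMapOfInjective _ hinj).toEquiv).symm.trans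
      hcard₀
  · rintro P ⟨Q, hQ, rfl⟩ h2P hP0
    have h2Q : 2 • Q = 0 := hinj (by rw [map_nsmul, map_zero]; exact h2P)
    have hQ0 : Q ≠ 0 := by
      rintro rfl
      exact hP0 (map_zero _)
    rw [huniq Q hQ h2Q hQ0]
    exact hTT

/-- STUB 8 (normalisation): a cyclic `ℚ`-isogeny of degree `2ᵏ`, `k ≥ 1`, out of an elliptic curve
over `ℚ` yields, on a `ℚ`-isomorphic model `y² = x³ + ax² + bx`, a `Γ_ℚ`-stable cyclic subgroup of
order `2ᵏ` whose element of order `2` is `T = (0,0)` (the kernel; its `2`-torsion point is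
`Γ_ℚ`-fixed hence rational, and is moved to `(0,0)` by `isTwoTorsionNF_smul_of_two_nsmul_eq_zero`;
transport along the isomorphism `VariableChange.toIsogeny`): `exists_twoTorsionNF_of_isCyclic_isogeny`
over `ℚ`. [cite: SilvermanAEC2009, III.4 Example 4.5, X.4.9] -/
theorem stub_twoNormalize :
    ∀ (W W' : WeierstrassCurve ℚ) [W.IsElliptic] [W'.IsElliptic] (ψ : Isogeny W W') (k : ℕ),
      1 ≤ k → ψ.IsCyclic → ψ.degree = 2 ^ k →
      ∃ (a b : ℚ) (_ : (⟨0, a, 0, b, 0⟩ : WeierstrassCurve ℚ).IsElliptic)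
        (C : AddSubgroup (⟨0, a, 0, b, 0⟩ : WeierstrassCurve ℚ).geomPoints),
        (∀ σ : Field.absoluteGaloisGroup ℚ, ∀ P ∈ C, σ • P ∈ C) ∧ IsAddCyclic C ∧
          Nat.card C = 2 ^ k ∧
          ∀ P ∈ C, 2 • P = 0 → P ≠ 0 →
            P = (⟨0, a, 0, b, 0⟩ : WeierstrassCurve ℚ).geomTwoTorsionPoint := by
  intro W W' _ _ ψ k hk hcyc hdeg
  exact exists_twoTorsionNF_of_isCyclic_isogeny two_ne_zero W W' ψ hk hcyc hdeg

end Summit.ABC.ABC.Theorems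

end
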